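import Summits.ABC.StewartYu.PadicTwistFunctions
import HarnessLib

/-!
# Cell abc-stewartyu, WP-Y provider B (iii-b): the ± bridge at ODD integer points

`Summits/ABC/StewartYu/PadicTwistPMBridge.lean` — cell `abc-stewartyu` (HOME `run/shared/lean/pub/abc-stewartyu/`,
seat p3; crux `W80OneModFour` stmt-ABC-19487, line `parity-twist-w80`; memo HOME/p3/memo-05 §2). First ADD-ON
file of the `p ≡ 1 (mod 4)` provider on p2's (re-landed, any-order) twist chain: on a ± class
(`cls u = sgn(u)·ρ`, `sgn(u) = ±1` on the support) the auxiliary function built on the SIGN-TWISTED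
coefficients `sgn·pv` takes at every ODD natural number `s` the value `ρˢ · coreSum(pv)(s)` — the signs
cancel because `sgn^{s+1} = 1` — so the rational side of the k-step is untouched (`Φ_natCast_pm`,
`norm_Φ_natCast_pm`). Kernel-checked beforehand inside HOME/p3/lean/pm/CHECK_PM_chain.lean. [folklore].
-/

noncomputable section

open NormedSpace Finset IsUltrametricDist
open Literature.NumberTheory.Transcendental
open Literature.NumberTheory.Transcendental.CW77.Setup (Idx Tau tauNorm)
open scoped Nat

namespace Summit.ABC.StewartYu

namespace TwistSetup

variable {p : ℕ} [Fact p.Prime] (S : TwistSetup p) {h Lb : ℕ}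

/-- **On a ± class, `φ_{J,τ}(s) = ρˢ · coreSum(s)` at an ODD natural number `s` for the SIGN-TWISTED
coefficients** (memo-05 §2): if every unknown with `pv u ≠ 0` has class value `sgn(u)·ρ`,
`sgn(u) = ±1`, then `φ` built on `sgn·pv` equals `ρˢ · coreSum(pv)(s)` — the signs cancel because
`sgn^{s+1} = 1`. [folklore] -/
theorem Φ_natCast_pm (J₀ J : ℕ) (box : Finset (Idx S.d h Lb)) (pv sgn : Idx S.d h Lb → ℤ)
    (hsgn : ∀ u ∈ box, pv u ≠ 0 → sgn u = 1 ∨ sgn u = -1)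
    {ρ : ℚ_[p]} (hcls : ∀ u ∈ box, pv u ≠ 0 → S.cls u = (sgn u : ℚ_[p]) * ρ) (τ : Tau S.d) (s : ℕ)
    (hs : Odd s) :
    S.Φ J₀ J box (fun u => sgn u * pv u) τ (s : ℚ_[p]) =
      ρ ^ s * (S.toQ.coreSum J₀ J box pv τ s : ℚ_[p]) := by
  unfold Φ SetupQ.coreSum
  push_cast
  rw [mul_sum]
  refine sum_congr rfl fun u hu => ?_
  by_cases h0 : pv u = 0
  · rw [h0]; simp
  · rw [S.termΦ_natCast, hcls u hu h0, mul_pow]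
    have hsq : ((sgn u : ℚ_[p])) ^ (s + 1) = 1 := by
      obtain ⟨k, hk⟩ := hs
      rcases hsgn u hu h0 with h1 | h1 <;> rw [h1] <;> push_cast
      · exact one_pow _
      · rw [hk, show 2 * k + 1 + 1 = 2 * (k + 1) by ring, pow_mul]; norm_num
    calc ((sgn u : ℤ) : ℚ_[p]) * (pv u : ℚ_[p]) *
          ((sgn u : ℚ_[p]) ^ s * ρ ^ s * (S.toQ.qTerm J₀ J u τ s : ℚ_[p]))
        = (sgn u : ℚ_[p]) ^ (s + 1) * (ρ ^ s * ((pv u : ℚ_[p]) * (S.toQ.qTerm J₀ J u τ s : ℚ_[p]))) := by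
          ring
      _ = ρ ^ s * ((pv u : ℚ_[p]) * (S.toQ.qTerm J₀ J u τ s : ℚ_[p])) := by rw [hsq, one_mul]

/-- **On a ± class, `‖φ_{J,τ}(s)‖ = ‖coreSum(s)‖_p` at odd `s`** (sign-twisted coefficients,
`ρ^G = 1`). [folklore] -/
theorem norm_Φ_natCast_pm (J₀ J : ℕ) (box : Finset (Idx S.d h Lb)) (pv sgn : Idx S.d h Lb → ℤ)
    (hsgn : ∀ u ∈ box, pv u ≠ 0 → sgn u = 1 ∨ sgn u = -1)
    {ρ : ℚ_[p]} (hcls : ∀ u ∈ box, pv u ≠ 0 → S.cls u = (sgn u : ℚ_[p]) * ρ) (hρ : ρ ^ S.G = 1)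
    (τ : Tau S.d) (s : ℕ) (hs : Odd s) :
    ‖S.Φ J₀ J box (fun u => sgn u * pv u) τ (s : ℚ_[p])‖ =
      ‖(S.toQ.coreSum J₀ J box pv τ s : ℚ_[p])‖ := by
  have hn : ‖ρ‖ = 1 := by
    have h := congrArg (‖·‖) hρ
    simp only [norm_pow, norm_one] at h
    exact (pow_eq_one_iff_of_nonneg (norm_nonneg _) S.hG.ne').mp h
  rw [S.Φ_natCast_pm J₀ J box pv sgn hsgn hcls τ s hs, norm_mul, norm_pow, hn, one_pow, one_mul]


end TwistSetup

end Summit.ABC.StewartYu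

end
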